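import Mathlib
import Summits.Schanuel.Schanuel.Theses.RigidCore
import Summits.Schanuel.Schanuel.Theorems.RigidCoreMinimalCounterexampleInAclLogSector
import Summits.Schanuel.Schanuel.Theorems.RigidCoreMinimalCounterexampleInAclOfSparsityTwo
import Summits.Schanuel.Schanuel.Theorems.MinimalCounterexampleInAcl.Negative.FirstFailureEcl
import Literature.NumberTheory.Transcendental.GenericPointTranscendence
import Literature.NumberTheory.Transcendental.TrdegZariskiDim
import Literature.RingTheory.KrullDimension.AffineDimension

/-!
# The residue of the line `kernel-arithmetic-selection` in EVERY rank is sparsity of independent exponential points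

Route `RigidCore`, crux (S*) `MinimalCounterexampleInAcl` (item stmt-Schanuel-0969), `--supports stmt-Schanuel-0969`,
registered stub `sparsity_iff_locusMates_finite` (lead prover-line-stmt-Schanuel-0969-c2-0).

The line proves (S*) from FINITENESS OF THE MATE SET `locusMates x` of every first failure `x`; its two open stubs are
this finiteness at rank `2` and at ranks `≥ 3`.  `RigidCoreMinimalCounterexampleInAclResidues.lean` identified the rank-2
residue with the crux `SparsityTwo`.  Here the same identification is proved in EVERY rank `n`, under the crux's own
inductive hypothesis `∀ r < n, SchanuelRank r` (a theorem for `n = 2`):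

  `Sparsity n` :⟺ every `W ⊆ ℂⁿ × ℂⁿ` defined over `ℚ` with `zariskiDim ℂ W < n` carries finitely many ℚ-linearly
  independent exponential points `(x, eˣ)`,

* `locusMates_finite_of_sparsity` (`→`, Schanuel-free): `(x, eˣ)` lies on a `ℚ`-variety of dimension `< n`
  (`exists_definedOver_mem_zariskiDim_lt_iff`, least dimension = `trdeg`) and so does every mate;
* `indepExpPoints_finite_of_locusMates_finite_rank` (`←`, uses `SchanuelRank r`, `r < n`): an independent point `x` of
  `W` has `trdeg ℚ(x, eˣ) < n` (`trdeg_adjoin_lt_of_mem_of_zariskiDim_lt`), so it is a rank-`n` FIRST FAILURE, of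
  transcendence degree EXACTLY `n − 1` (`pred_le_trdeg_of_ranks_below`); its relation ideal `P_x ⊆ ℚ[X, Y]` contains the
  `ℚ`-ideal `J` of `W` with `dim Z_ℂ(J) ≤ n − 1 ≤ trdeg`, hence is a MINIMAL PRIME over `J`
  (`ker_aeval_mem_minimalPrimes_of_algebraicIndependent`: a prime `J ≤ 𝔭 < P_x` would give an affine domain
  `ℚ[X]/𝔭` of `trdeg ≤ dim ≤ n − 1` with a proper quotient `ℚ[X]/P_x ↪ ℂ` still carrying `n − 1` algebraically
  independent coordinates, against `trdeg (B ⧸ 𝔮) < trdeg B`); finitely many minimal primes, one mate family each.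

So `sparsity_iff_locusMates_finite`: at a first-failure rank the residue of this line is `Sparsity n` verbatim — in
particular nothing is lost by attacking sparsity for ARBITRARY `ℚ`-varieties of dimension `< n` (their independent
points are automatically co-generic first failures with finitely many relation ideals), and `crux_of_sparsity`:
(S*) follows from `∀ n, Sparsity n` with no further input (the planners' "Conjecture L∞" shape of the crux).

References: J. Kirby, *Exponential algebraicity in exponential fields*, arXiv:0810.4285, Prop. 7.2; U. Görtz,
T. Wedhorn, *Algebraic Geometry I* (2020), Prop. 5.38; H. Matsumura, *Commutative Ring Theory* (1986), Thm 5.6.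
-/

noncomputable section

set_option linter.dupNamespace false

open Complex Set
open Literature.NumberTheory.Transcendental

namespace Summit.Schanuel.Schanuel.Cruxes.MinimalCounterexampleInAcl.KernelArithmeticSelection

open Summit.Schanuel.Schanuel.Theorems
open Summit.Schanuel.Schanuel.Theorems.MinimalCounterexampleInAcl.Negative (pred_le_trdeg_of_ranks_below)

/-! ## Commutative algebra: relation ideals of points of large transcendence degree are minimal primes -/

/-- **No prime strictly between `J` and the relation ideal of a point carrying `d` algebraically independent polynomial
values, when `dim Z_ℂ(J) ≤ d`.**  Let `J ⊆ ℚ[X_ι]` with `dim ℂ[X] ⧸ I(Z_ℂ(J)) ≤ d`, `w ∈ Z_ℂ(J)`, and `v : κ → ℚ[X_ι]` with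
`#κ ≥ d` and `(v_j(w))_j` algebraically independent over `ℚ`.  Then `P_w = ker (aeval w)` is a minimal prime over `J`:
for a prime `J ≤ 𝔭 < P_w` the affine domain `B = ℚ[X] ⧸ 𝔭` has `trdeg B = dim B ≤ dim ℚ[X] ⧸ J ≤ d`, its quotient by
the non-zero prime `𝔮 = P_w / 𝔭` has `trdeg (B ⧸ 𝔮) < trdeg B`, yet `B ⧸ 𝔮 → ℂ` still carries the `d` independent
values. [cite: GortzWedhorn2020, Prop. 5.38] [cite: Matsumura1987, Thm 5.6] -/
theorem ker_aeval_mem_minimalPrimes_of_algebraicIndependent {ι : Type} [Finite ι]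
    (J : Ideal (MvPolynomial ι ℚ)) {d : ℕ}
    (hdim : ringKrullDim (MvPolynomial ι ℂ ⧸ MvPolynomial.vanishingIdeal ℂ (MvPolynomial.zeroLocus ℂ J)) ≤ d)
    {w : ι → ℂ} (hw : ∀ g ∈ J, MvPolynomial.aeval w g = 0)
    {κ : Type} [Fintype κ] (v : κ → MvPolynomial ι ℚ)
    (hv : AlgebraicIndependent ℚ (fun j => MvPolynomial.aeval w (v j))) (hcard : d ≤ Fintype.card κ) :
    RingHom.ker (MvPolynomial.aeval w : MvPolynomial ι ℚ →ₐ[ℚ] ℂ) ∈ J.minimalPrimes := by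
  classical
  set P : Ideal (MvPolynomial ι ℚ) := RingHom.ker (MvPolynomial.aeval w : MvPolynomial ι ℚ →ₐ[ℚ] ℂ) with hPdef
  haveI hPp : P.IsPrime := RingHom.ker_isPrime _
  have hJP : J ≤ P := fun g hg => (RingHom.mem_ker).2 (hw g hg)
  obtain ⟨𝔭, h𝔭, h𝔭P⟩ := Ideal.exists_minimalPrimes_le hJP
  suffices h : 𝔭 = P by rwa [h] at h𝔭
  haveI h𝔭p : 𝔭.IsPrime := h𝔭.1.1
  have hJ𝔭 : J ≤ 𝔭 := h𝔭.1.2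
  by_contra hne
  -- the affine domain `B = ℚ[X] ⧸ 𝔭`, of dimension `≤ d`
  set B := MvPolynomial ι ℚ ⧸ 𝔭 with hB
  haveI : IsDomain B := Ideal.Quotient.isDomain 𝔭
  haveI : Algebra.FiniteType ℚ B :=
    Algebra.FiniteType.of_surjective (Ideal.Quotient.mkₐ ℚ 𝔭) (Ideal.Quotient.mkₐ_surjective ℚ 𝔭)
  have hdimB : ringKrullDim B ≤ d :=
    (ringKrullDim_le_of_surjective (Ideal.Quotient.factor hJ𝔭)
      (Ideal.Quotient.factor_surjective hJ𝔭)).trans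
      ((ringKrullDim_quotient_le_of_zeroLocus (F := ℂ) J).trans hdim)
  obtain ⟨s, hs, ht⟩ := Literature.RingTheory.KrullDimension.exists_ringKrullDim_eq_and_trdeg_eq ℚ B
  have hsd : s ≤ d := by
    rw [hs] at hdimB
    exact_mod_cast hdimB
  -- the non-zero prime `𝔮 = P / 𝔭` of `B`
  set 𝔮 : Ideal B := P.map (Ideal.Quotient.mk 𝔭) with h𝔮def
  haveI h𝔮p : 𝔮.IsPrime :=
    Ideal.map_isPrime_of_surjective Ideal.Quotient.mk_surjective (by rw [Ideal.mk_ker]; exact h𝔭P)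
  have h𝔮0 : 𝔮 ≠ ⊥ := by
    intro h0
    apply hne
    refine le_antisymm h𝔭P fun f hf => ?_
    have hf' : Ideal.Quotient.mk 𝔭 f ∈ 𝔮 := Ideal.mem_map_of_mem _ hf
    rw [h0, Ideal.mem_bot] at hf'
    exact Ideal.Quotient.eq_zero_iff_mem.1 hf'
  have hlt := Literature.RingTheory.KrullDimension.trdeg_quotient_lt ℚ (A := B) h𝔮0
  -- `B ⧸ 𝔮 → ℂ` induced by `aeval w`
  haveI : IsDomain (B ⧸ 𝔮) := Ideal.Quotient.isDomain 𝔮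
  haveI : Algebra.FiniteType ℚ (B ⧸ 𝔮) := inferInstance
  let φ : B →ₐ[ℚ] ℂ := Ideal.Quotient.liftₐ 𝔭 (MvPolynomial.aeval w) fun a ha => (RingHom.mem_ker).1 (h𝔭P ha)
  have hφ : ∀ b ∈ 𝔮, φ b = 0 := by
    intro b hb
    rw [h𝔮def, Ideal.mem_map_iff_of_surjective _ Ideal.Quotient.mk_surjective] at hb
    obtain ⟨f, hf, rfl⟩ := hb
    exact (RingHom.mem_ker).1 hf
  let ψ : (B ⧸ 𝔮) →ₐ[ℚ] ℂ := Ideal.Quotient.liftₐ 𝔮 φ hφ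
  let u : κ → B ⧸ 𝔮 := fun j => Ideal.Quotient.mk 𝔮 (Ideal.Quotient.mk 𝔭 (v j))
  have hψu : (fun j => MvPolynomial.aeval w (v j)) = ψ ∘ u := by
    funext j
    rfl
  rw [hψu] at hv
  have hu : AlgebraicIndependent ℚ u := AlgebraicIndependent.of_comp ψ hv
  -- count: `d ≤ #κ ≤ trdeg (B ⧸ 𝔮) < trdeg B = s ≤ d`
  obtain ⟨t, -, ht'⟩ := Literature.RingTheory.KrullDimension.exists_ringKrullDim_eq_and_trdeg_eq ℚ (B ⧸ 𝔮)
  have hcardle := hu.lift_cardinalMk_le_trdeg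
  rw [ht', Cardinal.mk_fintype, Cardinal.lift_natCast, Cardinal.lift_natCast] at hcardle
  rw [ht, ht'] at hlt
  have h1 : Fintype.card κ ≤ t := by exact_mod_cast hcardle
  have h2 : t < s := by exact_mod_cast hlt
  omega

/-! ## First failures: tightness read as an algebraically independent coordinate family -/

/-- At a first failure of rank `n` there are `n − 1` algebraically independent COORDINATES of `(x, eˣ)` (the
transcendence degree is exactly `n − 1`, `pred_le_trdeg_of_ranks_below`, and a maximal independent set of coordinates
computes it, `trdeg_adjoin_le_card`). [cite: Kirby2010, §1] -/
theorem exists_algebraicIndependent_coords_of_mem_firstFailures {n : ℕ} {x : Fin n → ℂ}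
    (hx : x ∈ firstFailures n) :
    ∃ S : Finset (Fin n ⊕ Fin n), n - 1 ≤ S.card ∧
      AlgebraicIndependent ℚ (fun i : S => Sum.elim x (cexp ∘ x) i) := by
  classical
  obtain ⟨S, hS, halg⟩ := exists_finset_algebraicIndependent_maximal (Sum.elim x (cexp ∘ x))
  refine ⟨S, ?_, hS⟩
  have h1 := trdeg_adjoin_le_card (Sum.elim x (cexp ∘ x)) S halg
  rw [Set.Sum.elim_range] at h1
  have h2 := pred_le_trdeg_of_ranks_below hx.1 hx.2.2
  exact_mod_cast h2.trans h1

/-- **The relation ideal of a first failure lying on a `ℚ`-variety of dimension `< n` is a minimal prime over the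
`ℚ`-ideal of the variety.** [cite: GortzWedhorn2020, Prop. 5.38] -/
theorem ker_aeval_mem_minimalPrimes_of_mem_firstFailures {n : ℕ} (J : Ideal (MvPolynomial (Fin n ⊕ Fin n) ℚ))
    (hdim : ringKrullDim (MvPolynomial (Fin n ⊕ Fin n) ℂ ⧸
      MvPolynomial.vanishingIdeal ℂ (MvPolynomial.zeroLocus ℂ J)) ≤ (n - 1 : ℕ))
    {x : Fin n → ℂ} (hx : x ∈ firstFailures n) (hxJ : ∀ g ∈ J, MvPolynomial.aeval (Sum.elim x (cexp ∘ x)) g = 0) :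
    RingHom.ker (MvPolynomial.aeval (Sum.elim x (cexp ∘ x)) : MvPolynomial (Fin n ⊕ Fin n) ℚ →ₐ[ℚ] ℂ) ∈
      J.minimalPrimes := by
  classical
  obtain ⟨S, hcard, hS⟩ := exists_algebraicIndependent_coords_of_mem_firstFailures hx
  refine ker_aeval_mem_minimalPrimes_of_algebraicIndependent J hdim hxJ
    (κ := S) (fun i => MvPolynomial.X i.1) ?_ ?_
  · have : (fun j : S => MvPolynomial.aeval (Sum.elim x (cexp ∘ x))
        (MvPolynomial.X j.1 : MvPolynomial (Fin n ⊕ Fin n) ℚ)) = fun i : S => Sum.elim x (cexp ∘ x) i := by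
      funext j
      rw [MvPolynomial.aeval_X]
    rw [this]
    exact hS
  · rwa [Fintype.card_coe]

/-- `d < m + 1 → d ≤ m` in `WithBot ℕ∞` (dimension bookkeeping). [folklore] -/
theorem withBot_enat_le_of_lt_succ {d : WithBot ℕ∞} {m : ℕ} (h : d < ((m + 1 : ℕ) : WithBot ℕ∞)) :
    d ≤ (m : WithBot ℕ∞) := by
  induction d using WithBot.recBotCoe with
  | bot => exact bot_le
  | coe e =>
    rw [← WithBot.coe_natCast, WithBot.coe_lt_coe, Nat.cast_succ] at h
    rw [← WithBot.coe_natCast, WithBot.coe_le_coe]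
    exact (ENat.lt_add_one_iff (ENat.coe_ne_top m)).1 h

/-! ## `Sparsity n` ⟹ mate finiteness (Schanuel-free) -/

/-- **Sparsity at rank `n` gives finiteness of the mate set of every rank-`n` counterexample tuple** (no first-failure
hypothesis needed): `(x, eˣ)` lies on a `ℚ`-variety `W` of dimension `< n` (least dimension `= trdeg < n`) and every
mate lies on the same `W`. [folklore] -/
theorem locusMates_finite_of_sparsity {n : ℕ}
    (hSp : ∀ W : Set (Fin n ⊕ Fin n → ℂ), IsDefinedOver (⊥ : Subfield ℂ) W → zariskiDim ℂ W < n →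
      Set.Finite {x : Fin n → ℂ | LinearIndependent ℚ x ∧ Sum.elim x (cexp ∘ x) ∈ W})
    {x : Fin n → ℂ}
    (htr : Algebra.trdeg ℚ ↥(IntermediateField.adjoin ℚ (Set.range x ∪ Set.range (cexp ∘ x))) < (n : Cardinal)) :
    (locusMates x).Finite := by
  have htr' : Algebra.trdeg ℚ ↥(IntermediateField.adjoin ℚ (Set.range (Sum.elim x (cexp ∘ x)))) < (n : Cardinal) := by
    rwa [Set.Sum.elim_range]
  obtain ⟨W, hW, hxW, hd⟩ := (exists_definedOver_mem_zariskiDim_lt_iff (Sum.elim x (cexp ∘ x)) n).2 htr'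
  refine (hSp W hW hd).subset ?_
  rintro x' ⟨hx', hrel⟩
  exact ⟨hx', mem_of_isDefinedOver_bot_of_relations hW hxW hrel⟩

/-! ## Mate finiteness ⟹ `Sparsity n` at a first-failure rank -/

/-- An independent exponential point of a `ℚ`-variety of dimension `< n` in `ℂⁿ × ℂⁿ` is a rank-`n` first failure, GIVEN
Schanuel in the ranks `< n`. [folklore] -/
theorem mem_firstFailures_of_mem {n : ℕ} (hSR : ∀ r < n, SchanuelRank r) {W : Set (Fin n ⊕ Fin n → ℂ)}
    (hW : IsDefinedOver (⊥ : Subfield ℂ) W) (hd : zariskiDim ℂ W < n) {x : Fin n → ℂ} (hx : LinearIndependent ℚ x)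
    (hxW : Sum.elim x (cexp ∘ x) ∈ W) : x ∈ firstFailures n := by
  refine ⟨hx, ?_, hSR⟩
  have h := trdeg_adjoin_lt_of_mem_of_zariskiDim_lt (d := n) hW hxW (by exact_mod_cast hd)
  rw [Set.Sum.elim_range] at h
  exact_mod_cast h

/-- **At a first-failure rank, finiteness of all mate sets gives `Sparsity n`.**  The relation ideals of the independent
exponential points of `W` are minimal primes over the `ℚ`-ideal of `W` — finitely many — and each fibre of `x ↦ P_x`
lies in one mate set. [cite: GortzWedhorn2020, Prop. 5.38] -/
theorem indepExpPoints_finite_of_locusMates_finite_rank {n : ℕ} (hSR : ∀ r < n, SchanuelRank r)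
    (hfin : ∀ x : Fin n → ℂ, x ∈ firstFailures n → (locusMates x).Finite)
    (W : Set (Fin n ⊕ Fin n → ℂ)) (hW : IsDefinedOver (⊥ : Subfield ℂ) W) (hd : zariskiDim ℂ W < n) :
    Set.Finite {x : Fin n → ℂ | LinearIndependent ℚ x ∧ Sum.elim x (cexp ∘ x) ∈ W} := by
  classical
  obtain ⟨I, hI⟩ := hW
  -- the `ℚ`-ideal of `W`
  set J : Ideal (MvPolynomial (Fin n ⊕ Fin n) ℚ) := I.comap (MvPolynomial.map ratToBot) with hJ
  have hWJ : W = MvPolynomial.zeroLocus ℂ J := by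
    rw [hI]
    ext w
    simp only [MvPolynomial.mem_zeroLocus_iff]
    constructor
    · intro h g hg
      have := h _ (Ideal.mem_comap.1 hg)
      rwa [aeval_map_ratToBot] at this
    · intro h f hf
      obtain ⟨g, rfl⟩ := MvPolynomial.map_surjective ratToBot ratToBot_surjective f
      rw [aeval_map_ratToBot]
      exact h g (Ideal.mem_comap.2 hf)
  set S : Set (Fin n → ℂ) := {x : Fin n → ℂ | LinearIndependent ℚ x ∧ Sum.elim x (cexp ∘ x) ∈ W} with hS
  -- no independent points unless `n ≥ 1`; then `dim Z_ℂ(J) ≤ n - 1`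
  rcases Nat.eq_zero_or_pos n with rfl | hn
  · refine (Set.finite_singleton (fun i : Fin 0 => (0 : ℂ))).subset ?_
    intro x _
    exact funext fun i => i.elim0
  have hdimJ : ringKrullDim (MvPolynomial (Fin n ⊕ Fin n) ℂ ⧸
      MvPolynomial.vanishingIdeal ℂ (MvPolynomial.zeroLocus ℂ J)) ≤ (n - 1 : ℕ) := by
    have h : zariskiDim ℂ (MvPolynomial.zeroLocus ℂ J) < ((n - 1 + 1 : ℕ) : WithBot ℕ∞) := by
      rw [Nat.sub_add_cancel hn, ← hWJ]
      exact_mod_cast hd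
    exact withBot_enat_le_of_lt_succ h
  -- the relation ideal of a point
  let P : (Fin n → ℂ) → Ideal (MvPolynomial (Fin n ⊕ Fin n) ℚ) := fun x =>
    RingHom.ker (MvPolynomial.aeval (Sum.elim x (cexp ∘ x)) : MvPolynomial (Fin n ⊕ Fin n) ℚ →ₐ[ℚ] ℂ)
  have hff : ∀ x ∈ S, x ∈ firstFailures n := fun x hx => mem_firstFailures_of_mem hSR ⟨I, hI⟩ hd hx.1 hx.2
  have hmin : ∀ x ∈ S, P x ∈ J.minimalPrimes := by
    intro x hx
    have hxW := hx.2
    rw [hWJ, MvPolynomial.mem_zeroLocus_iff] at hxW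
    exact ker_aeval_mem_minimalPrimes_of_mem_firstFailures J hdimJ (hff x hx) hxW
  have hfinmin : J.minimalPrimes.Finite := Ideal.finite_minimalPrimes_of_isNoetherianRing _ J
  refine (hfinmin.biUnion (t := fun 𝔭 => {x ∈ S | P x = 𝔭}) ?_).subset ?_
  · intro 𝔭 _
    by_cases hne : ({x ∈ S | P x = 𝔭} : Set (Fin n → ℂ)).Nonempty
    · obtain ⟨x₀, hx₀S, hx₀P⟩ := hne
      refine (hfin x₀ (hff x₀ hx₀S)).subset ?_
      rintro x' ⟨hx'S, hx'P⟩
      refine ⟨hx'S.1, fun p hp => ?_⟩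
      have hp' : p ∈ P x₀ := (RingHom.mem_ker).2 hp
      rw [hx₀P, ← hx'P] at hp'
      exact (RingHom.mem_ker).1 hp'
    · rw [Set.not_nonempty_iff_eq_empty.1 hne]
      exact Set.finite_empty
  · intro x hx
    exact Set.mem_iUnion₂.2 ⟨P x, hmin x hx, hx, rfl⟩

/-! ## The registered stub and the Conjecture-L∞ form of the crux -/

/-- **Registered stub `sparsity_iff_locusMates_finite` (PROVED): at a first-failure rank `n` (Schanuel in all ranks
`< n`), sparsity of ℚ-independent exponential points on `ℚ`-varieties of dimension `< n` in `ℂⁿ × ℂⁿ` is EQUIVALENT to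
finiteness of the mate set of every rank-`n` first failure** — the residue of the line `kernel-arithmetic-selection` in
every rank is `Sparsity n` verbatim (rank 2: `sparsityTwo_iff_rankTwo_locusMates_finite`).
[cite: GortzWedhorn2020, Prop. 5.38] -/
theorem sparsity_iff_locusMates_finite : ∀ (n : ℕ), (∀ r < n, Literature.NumberTheory.Transcendental.SchanuelRank r) → ((∀ W : Set (Fin n ⊕ Fin n → ℂ), Literature.NumberTheory.Transcendental.IsDefinedOver (⊥ : Subfield ℂ) W → Literature.NumberTheory.Transcendental.zariskiDim ℂ W < n → Set.Finite {x : Fin n → ℂ | LinearIndependent ℚ x ∧ Sum.elim x (Complex.exp ∘ x) ∈ W}) ↔ ∀ x : Fin n → ℂ, x ∈ Summit.Schanuel.Schanuel.Cruxes.MinimalCounterexampleInAcl.KernelArithmeticSelection.firstFailures n → (Summit.Schanuel.Schanuel.Cruxes.MinimalCounterexampleInAcl.KernelArithmeticSelection.locusMates x).Finite) := by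
  intro n hSR
  constructor
  · intro hSp x hx
    exact locusMates_finite_of_sparsity hSp hx.2.1
  · intro hfin W hW hd
    exact indepExpPoints_finite_of_locusMates_finite_rank hSR hfin W hW hd

/-- **(S*) in Conjecture-L∞ form**: if for every `n` every `ℚ`-variety `W ⊆ ℂⁿ × ℂⁿ` of dimension `< n` carries finitely
many ℚ-linearly independent exponential points, then every coordinate of every first-failure counterexample to
Schanuel's conjecture lies in a finite `∅`-definable subset of `ℂ_exp` — with no model theory and no inductive input
left (definable isolation is free, `coord_mem_expAcl_of_sparsity`). [cite: Kirby2010, Prop. 7.2] -/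
theorem crux_of_sparsity
    (hSp : ∀ (n : ℕ) (W : Set (Fin n ⊕ Fin n → ℂ)), IsDefinedOver (⊥ : Subfield ℂ) W → zariskiDim ℂ W < n →
      Set.Finite {x : Fin n → ℂ | LinearIndependent ℚ x ∧ Sum.elim x (cexp ∘ x) ∈ W}) :
    Summit.Schanuel.Schanuel.Theses.RigidCore.MinimalCounterexampleInAcl := by
  intro n x hx htr hSR i
  exact coord_mem_expAcl_of_sparsity ⟨hx, htr, hSR⟩ (locusMates_finite_of_sparsity (hSp n) htr) i

/-- Conversely, **(S*)'s finiteness content at rank `n` is no weaker than `Sparsity n`**: if every rank-`n` first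
failure has a finite mate set (the line's residue) then, given Schanuel below `n`, `Sparsity n` holds — so a proof of
the residue at the first open rank IS a proof of sparsity for all `ℚ`-varieties of dimension `< n`. [folklore] -/
theorem sparsity_of_locusMates_finite {n : ℕ} (hSR : ∀ r < n, SchanuelRank r)
    (hfin : ∀ x : Fin n → ℂ, x ∈ firstFailures n → (locusMates x).Finite)
    (W : Set (Fin n ⊕ Fin n → ℂ)) (hW : IsDefinedOver (⊥ : Subfield ℂ) W) (hd : zariskiDim ℂ W < n) :
    Set.Finite {x : Fin n → ℂ | LinearIndependent ℚ x ∧ Sum.elim x (cexp ∘ x) ∈ W} :=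
  ((sparsity_iff_locusMates_finite n hSR).2 hfin) W hW hd

/-- **Item stmt-Schanuel-14744 in Conjecture-L∞ form**: sparsity of ℚ-independent exponential points on `ℚ`-varieties of
dimension `< n` in `ℂⁿ × ℂⁿ` for the ranks `n ≥ 3` alone gives the `3 ≤ n` slice `MinimalCounterexampleInAclGeThree` of
(S*). [cite: Kirby2010, Prop. 7.2] -/
theorem minimalCounterexampleInAclGeThree_of_sparsity
    (hSp : ∀ (n : ℕ), 3 ≤ n → ∀ (W : Set (Fin n ⊕ Fin n → ℂ)), IsDefinedOver (⊥ : Subfield ℂ) W →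
      zariskiDim ℂ W < n → Set.Finite {x : Fin n → ℂ | LinearIndependent ℚ x ∧ Sum.elim x (cexp ∘ x) ∈ W}) :
    Summit.Schanuel.Schanuel.Theses.RigidCore.MinimalCounterexampleInAclGeThree := by
  intro n hn x hx htr hSR i
  exact coord_mem_expAcl_of_sparsity ⟨hx, htr, hSR⟩ (locusMates_finite_of_sparsity (hSp n hn) htr) i

/-- **(S*) from `SparsityTwo` and sparsity in the ranks `≥ 3`** (the landed glue stmt-14765 composed with the two
Conjecture-L∞ forms): the crux needs sparsity only rank by rank, and at rank 2 exactly the sibling crux `SparsityTwo`.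
[cite: Kirby2010, Prop. 7.2] -/
theorem crux_of_sparsityTwo_of_sparsity_ge_three (h₂ : Summit.Schanuel.Schanuel.Theses.RigidCore.SparsityTwo)
    (hSp : ∀ (n : ℕ), 3 ≤ n → ∀ (W : Set (Fin n ⊕ Fin n → ℂ)), IsDefinedOver (⊥ : Subfield ℂ) W →
      zariskiDim ℂ W < n → Set.Finite {x : Fin n → ℂ | LinearIndependent ℚ x ∧ Sum.elim x (cexp ∘ x) ∈ W}) :
    Summit.Schanuel.Schanuel.Theses.RigidCore.MinimalCounterexampleInAcl :=
  minimalCounterexampleInAclOfSparsityTwo_proof h₂ (minimalCounterexampleInAclGeThree_of_sparsity hSp)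

end Summit.Schanuel.Schanuel.Cruxes.MinimalCounterexampleInAcl.KernelArithmeticSelection

end
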